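import Summits.ABC.ABC.Theses.IneffectiveSubspace

/-!
# `TowerExponentWindow` (stmt-ABC-1647, route ABC/IneffectiveSubspace) — negative-side lemmas I: floors

Standing-adversary (cdisprove) output for the crux
`Summit.ABC.ABC.Theses.IneffectiveSubspace.TowerExponentWindow`
(`∃ n ≥ 1, ∃ A, 0 < A, 3A < n, TowerIneq(n, A)`, where `TowerIneq(n, A)` is Vojta's level-`n` tower
inequality `Π zᵢ^(i+1) < C(ε)·(Π xᵢyᵢzᵢ)^(A+ε)` on positive coprime solutions of
`Π xᵢ^(i+1) + Π yᵢ^(i+1) = Π zᵢ^(i+1)`).  The matrix is spelled out in every statement (no auxiliary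
definitions; one-spike vectors are `(Pi.mulSingle j m : Fin n → ℕ)`).  Proved here:

* `not_towerIneq_of_family` — generic engine: a family of level-`n` points with `c^q ≥ α·Π^p` and
  `Π → ∞` refutes the inequality for every `A < p/q` (any side condition `Q` in the coprimality slot);
* `not_towerIneq_of_lt_half` — exponent floor `1/2` at every level (`1 + m = m + 1` at the bottom index);
* `not_towerIneq_of_lt_one` — **floor `1` at every level `n ≥ 2`** (Pell family `1 + 3Z² = Y²`,
  Mathlib's `Pell.xn/yn` for `d = 3`, `c = Y² ≥ Π/2 = 3YZ/2`): Vojta's conjectured exponent `A_n = 1`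
  (items `TowerThesis`, `AbcGivesTower`) cannot be improved at any level;
* `four_le_of_window`, `towerExponentWindow_level_ge_four` — a window witness has `n ≥ 4` and
  `A ∈ [1, n/3)`; `not_towerExponentWindow_le_three`, `not_forall_level_window` — the strengthenings
  "window at a level `≤ 3`" / "window at every level" are false;
* `towerIneq_mono` — monotone in the exponent.

Companion file `TowerExponentWindowLoadBearing` (decorative / load-bearing hypotheses, `rad ≤ Π`,
polynomial abc ⟹ crux).  Refuter seat cdisprove-stmt-ABC-1647, 2026-08-16; work file
`Cruxes/TowerExponentWindow/Disproof.lean` (same lemmas plus the paper-level Fermat-fibre obstruction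
to Schmidt-shape inequalities on Vojta's tower).
-/

namespace Summit.ABC.ABC.Theorems.TowerExponentWindow.Negative

open scoped BigOperators
open Summit.ABC.ABC.Theses.IneffectiveSubspace

/-! ## Toolkit: one-spike vectors `(Pi.mulSingle j m : Fin n → ℕ)` (`m` at index `j`, `1` elsewhere) -/

/-- Entries of a one-spike vector are positive when the spike is. [folklore] -/
theorem mulSingle_pos {n : ℕ} (j : Fin n) {m : ℕ} (hm : 0 < m) (i : Fin n) :
    0 < (Pi.mulSingle j m : Fin n → ℕ) i := by
  rcases eq_or_ne i j with rfl | h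
  · simp [hm]
  · simp [Pi.mulSingle_eq_of_ne h]

/-- `Π (mulSingle j m)ᵢ^(i+1) = m^(j+1)`. [folklore] -/
theorem prod_mulSingle_pow_succ {n : ℕ} (j : Fin n) (m : ℕ) :
    ∏ i : Fin n, ((Pi.mulSingle j m : Fin n → ℕ) i) ^ (i.val + 1) = m ^ (j.val + 1) := by
  rw [Finset.prod_eq_single j]
  · simp
  · intro b _ hb
    simp [Pi.mulSingle_eq_of_ne hb]
  · intro h; exact absurd (Finset.mem_univ _) h

/-- `Π (fᵢgᵢ)^(i+1) = Π fᵢ^(i+1) · Π gᵢ^(i+1)`. [folklore] -/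
theorem prod_mul_pow_succ {n : ℕ} (f g : Fin n → ℕ) :
    ∏ i : Fin n, (f i * g i) ^ (i.val + 1) =
      (∏ i : Fin n, f i ^ (i.val + 1)) * ∏ i : Fin n, g i ^ (i.val + 1) := by
  rw [← Finset.prod_mul_distrib]; congr 1; ext i; ring

/-! ## Generic engine -/

/-- **Generic kill.** A family of level-`n` points `(x m, y m, z m)` satisfying the side condition `Q`,
with `c ^ q ≥ α · Π ^ p` (`α > 0`) and `Π` unbounded, refutes the level-`n` tower inequality with side
condition `Q` for every exponent `A < p / q`. [folklore] -/
theorem not_towerIneq_of_family {n : ℕ} {Q : (Fin n → ℕ) → (Fin n → ℕ) → (Fin n → ℕ) → Prop}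
    (x y z : ℕ → Fin n → ℕ)
    (hpos : ∀ m i, 0 < x m i ∧ 0 < y m i ∧ 0 < z m i)
    (heq : ∀ m, (∏ i, x m i ^ (i.val + 1)) + (∏ i, y m i ^ (i.val + 1)) = ∏ i, z m i ^ (i.val + 1))
    (hQ : ∀ m, Q (x m) (y m) (z m))
    {p q : ℕ} (hq : 0 < q) {α : ℝ} (hα : 0 < α)
    (hratio : ∀ m, α * ((∏ i, x m i * y m i * z m i : ℕ) : ℝ) ^ p ≤
      ((∏ i, z m i ^ (i.val + 1) : ℕ) : ℝ) ^ q)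
    (hunb : ∀ K : ℝ, ∃ m, K ≤ ((∏ i, x m i * y m i * z m i : ℕ) : ℝ))
    {A : ℝ} (hA : A * q < p) :
    ¬ ∀ ε : ℝ, 0 < ε → ∃ C : ℝ, 0 < C ∧ ∀ x y z : Fin n → ℕ, (∀ i, 0 < x i ∧ 0 < y i ∧ 0 < z i) →
      (∏ i, x i ^ (i.val + 1)) + (∏ i, y i ^ (i.val + 1)) = ∏ i, z i ^ (i.val + 1) →
      Q x y z →
      ((∏ i, z i ^ (i.val + 1) : ℕ) : ℝ) < C * ((∏ i, x i * y i * z i : ℕ) : ℝ) ^ (A + ε) := by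
  intro h
  have hqpos : (0:ℝ) < q := by exact_mod_cast hq
  set ε : ℝ := (p - A * q) / (2 * q) with hε_def
  have hε : 0 < ε := by rw [hε_def]; apply div_pos <;> linarith
  obtain ⟨C, hC, hall⟩ := h ε hε
  set s : ℝ := A + ε with hs_def
  have hs : s * q < p := by
    have : ε * q = (p - A * q) / 2 := by rw [hε_def]; field_simp
    rw [hs_def]; nlinarith
  set g : ℝ := p - s * q with hg_def
  have hg : 0 < g := by rw [hg_def]; linarith
  obtain ⟨m, hm⟩ := hunb (max 2 ((C ^ q / α) ^ (1 / g) + 1))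
  set P : ℝ := ((∏ i, x m i * y m i * z m i : ℕ) : ℝ) with hP_def
  set c : ℝ := ((∏ i, z m i ^ (i.val + 1) : ℕ) : ℝ) with hc_def
  have hP2 : 2 ≤ P := le_trans (le_max_left _ _) hm
  have hPpos : 0 < P := by linarith
  have hlt : c < C * P ^ s := hall (x m) (y m) (z m) (hpos m) (heq m) (hQ m)
  have hc0 : 0 ≤ c := by rw [hc_def]; exact_mod_cast Nat.zero_le _
  have h1 : c ^ q < C ^ q * P ^ (s * q) := by
    have h1a : c ^ q < (C * P ^ s) ^ q := pow_lt_pow_left₀ hlt hc0 hq.ne'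
    rw [mul_pow] at h1a
    have : (P ^ s) ^ q = P ^ (s * q) := by
      rw [← Real.rpow_natCast (P ^ s) q, ← Real.rpow_mul hPpos.le]
    rwa [this] at h1a
  have h2 : α * P ^ (p:ℝ) < C ^ q * P ^ (s * q) := by
    have := hratio m
    rw [← hP_def, ← hc_def] at this
    rw [Real.rpow_natCast]
    linarith
  have h3 : α * P ^ g < C ^ q := by
    have hsplit : P ^ (p:ℝ) = P ^ g * P ^ (s * q) := by
      rw [← Real.rpow_add hPpos]; congr 1; rw [hg_def]; ring
    rw [hsplit, ← mul_assoc] at h2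
    exact lt_of_mul_lt_mul_right h2 (Real.rpow_nonneg hPpos.le _)
  have h4 : C ^ q / α < P ^ g := by
    have hK : 0 ≤ C ^ q / α := div_nonneg (pow_nonneg hC.le _) hα.le
    have hPgt : (C ^ q / α) ^ (1 / g) < P := by
      have := le_max_right 2 ((C ^ q / α) ^ (1 / g) + 1)
      linarith
    calc C ^ q / α = ((C ^ q / α) ^ (1 / g)) ^ g := by
          rw [← Real.rpow_mul hK, one_div_mul_cancel hg.ne', Real.rpow_one]
      _ < P ^ g := Real.rpow_lt_rpow (Real.rpow_nonneg hK _) hPgt hg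
  rw [div_lt_iff₀ hα] at h4
  linarith [h3, h4]

/-! ## Floor `1/2` at every level -/

/-- FAMILY H (level `n ≥ 1`, ratio `1/2`): `x = 1`, `y = (m+1, 1, …)`, `z = (m+2, 1, …)`;
`1 + (m+1) = m+2`, `Π = (m+1)(m+2)`. [folklore] -/
theorem familyH_spec {n : ℕ} (hn : 1 ≤ n) (m : ℕ) :
    (∏ i : Fin n, (1 : Fin n → ℕ) i ^ (i.val + 1)) = 1 ∧
    (∏ i : Fin n, (Pi.mulSingle (⟨0, hn⟩ : Fin n) (m + 1) : Fin n → ℕ) i ^ (i.val + 1)) = m + 1 ∧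
    (∏ i : Fin n, (Pi.mulSingle (⟨0, hn⟩ : Fin n) (m + 2) : Fin n → ℕ) i ^ (i.val + 1)) = m + 2 ∧
    (∏ i : Fin n, (1 : Fin n → ℕ) i * (Pi.mulSingle (⟨0, hn⟩ : Fin n) (m + 1) : Fin n → ℕ) i *
      (Pi.mulSingle (⟨0, hn⟩ : Fin n) (m + 2) : Fin n → ℕ) i) = (m + 1) * (m + 2) := by
  refine ⟨by simp, by simpa using prod_mulSingle_pow_succ (⟨0, hn⟩ : Fin n) (m + 1),
    by simpa using prod_mulSingle_pow_succ (⟨0, hn⟩ : Fin n) (m + 2), ?_⟩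
  simp only [Pi.one_apply, one_mul, Finset.prod_mul_distrib, Fintype.prod_pi_mulSingle']

/-- **Floor `1/2` at every level:** the level-`n` tower inequality fails for every `A < 1/2`
(family H, `Π = (m+1)(m+2) ≤ c²`). [folklore] -/
theorem not_towerIneq_of_lt_half {n : ℕ} (hn : 1 ≤ n) {A : ℝ} (hA : A < 1 / 2) :
    ¬ ∀ ε : ℝ, 0 < ε → ∃ C : ℝ, 0 < C ∧ ∀ x y z : Fin n → ℕ, (∀ i, 0 < x i ∧ 0 < y i ∧ 0 < z i) →
      (∏ i, x i ^ (i.val + 1)) + (∏ i, y i ^ (i.val + 1)) = ∏ i, z i ^ (i.val + 1) →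
      Nat.Coprime (∏ i, x i ^ (i.val + 1)) (∏ i, y i ^ (i.val + 1)) →
      ((∏ i, z i ^ (i.val + 1) : ℕ) : ℝ) < C * ((∏ i, x i * y i * z i : ℕ) : ℝ) ^ (A + ε) := by
  refine not_towerIneq_of_family (Q := fun x y _ => Nat.Coprime (∏ i, x i ^ (i.val + 1))
      (∏ i, y i ^ (i.val + 1)))
    (fun _ => 1) (fun m => (Pi.mulSingle (⟨0, hn⟩ : Fin n) (m + 1) : Fin n → ℕ))
    (fun m => (Pi.mulSingle (⟨0, hn⟩ : Fin n) (m + 2) : Fin n → ℕ))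
    (fun m i => ⟨Nat.one_pos, mulSingle_pos _ (by omega) i, mulSingle_pos _ (by omega) i⟩)
    (fun m => ?_) (fun m => ?_) (p := 1) (q := 2) (by norm_num) (α := 1) one_pos
    (fun m => ?_) (fun K => ?_) (by push_cast; linarith)
  · obtain ⟨h1, h2, h3, -⟩ := familyH_spec hn m
    rw [h1, h2, h3]; omega
  · obtain ⟨h1, h2, -, -⟩ := familyH_spec hn m
    show Nat.Coprime _ _
    rw [h1, h2]; exact Nat.coprime_one_left _
  · obtain ⟨-, -, h3, h4⟩ := familyH_spec hn m
    rw [h3, h4]; push_cast; simp only [pow_one, one_mul]; nlinarith [sq_nonneg (m : ℝ)]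
  · obtain ⟨m, hm⟩ := exists_nat_ge K
    refine ⟨m, ?_⟩
    obtain ⟨-, -, -, h4⟩ := familyH_spec hn m
    rw [h4]; push_cast; nlinarith

/-! ## Floor `1` at every level `n ≥ 2`: the Pell family `Y² = 3Z² + 1` -/

/-- Mathlib's Pell sequences for `a = 2` (`d = a² − 1 = 3`): `xn² = 3·yn² + 1`. [folklore] -/
theorem pell_sq (k : ℕ) :
    Pell.xn Nat.one_lt_two k ^ 2 = 3 * Pell.yn Nat.one_lt_two k ^ 2 + 1 := by
  have h : (Pell.xn Nat.one_lt_two k : ℤ) * Pell.xn Nat.one_lt_two k -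
      ((2 * 2 - 1 : ℕ) : ℤ) * Pell.yn Nat.one_lt_two k * Pell.yn Nat.one_lt_two k = 1 :=
    Pell.pell_eqz Nat.one_lt_two k
  norm_num at h
  zify
  linear_combination h

/-- `2·xn ≥ 3·yn` (from `xn² > (9/4)·yn²`). [folklore] -/
theorem pell_three_yn_le (k : ℕ) : 3 * Pell.yn Nat.one_lt_two k ≤ 2 * Pell.xn Nat.one_lt_two k := by
  nlinarith [pell_sq k]

/-- FAMILY P (level `n ≥ 2`, ratio `1`): `x = 1`, `y = (3, Z, 1, …)`, `z = (1, Y, 1, …)` with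
`Y² = 3Z² + 1`; `a = 1`, `b = 3Z²`, `c = Y²`, `Π = 3ZY`. [folklore] -/
theorem familyP_spec {n : ℕ} (hn : 2 ≤ n) (Y Z : ℕ) :
    (∏ i : Fin n, (1 : Fin n → ℕ) i ^ (i.val + 1)) = 1 ∧
    (∏ i : Fin n, ((Pi.mulSingle (⟨0, by omega⟩ : Fin n) 3 : Fin n → ℕ) * (Pi.mulSingle (⟨1, hn⟩ : Fin n) Z : Fin n → ℕ)) i ^
      (i.val + 1)) = 3 * Z ^ 2 ∧
    (∏ i : Fin n, (Pi.mulSingle (⟨1, hn⟩ : Fin n) Y : Fin n → ℕ) i ^ (i.val + 1)) = Y ^ 2 ∧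
    (∏ i : Fin n, (1 : Fin n → ℕ) i *
      ((Pi.mulSingle (⟨0, by omega⟩ : Fin n) 3 : Fin n → ℕ) * (Pi.mulSingle (⟨1, hn⟩ : Fin n) Z : Fin n → ℕ)) i *
      (Pi.mulSingle (⟨1, hn⟩ : Fin n) Y : Fin n → ℕ) i) = 3 * Z * Y := by
  refine ⟨by simp, ?_, by simpa using prod_mulSingle_pow_succ (⟨1, hn⟩ : Fin n) Y, ?_⟩
  · simp only [Pi.mul_apply]
    rw [prod_mul_pow_succ, prod_mulSingle_pow_succ, prod_mulSingle_pow_succ]; ring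
  · simp only [Pi.one_apply, Pi.mul_apply, one_mul, Finset.prod_mul_distrib,
      Fintype.prod_pi_mulSingle']

/-- **Floor `1` at every level `n ≥ 2` — Vojta's exponent cannot be improved.**  The level-`n` tower
inequality fails for every `A < 1`: the Pell family `1 + 3Z² = Y²` has `c = Y² ≥ (1/2)·Π = (3/2)·YZ`,
`Π → ∞`.  (Level `2` is thus sharp at `A = 1 = n/2`; compare item `TowerLiouvilleExponent`.)
[folklore] -/
theorem not_towerIneq_of_lt_one {n : ℕ} (hn : 2 ≤ n) {A : ℝ} (hA : A < 1) :
    ¬ ∀ ε : ℝ, 0 < ε → ∃ C : ℝ, 0 < C ∧ ∀ x y z : Fin n → ℕ, (∀ i, 0 < x i ∧ 0 < y i ∧ 0 < z i) →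
      (∏ i, x i ^ (i.val + 1)) + (∏ i, y i ^ (i.val + 1)) = ∏ i, z i ^ (i.val + 1) →
      Nat.Coprime (∏ i, x i ^ (i.val + 1)) (∏ i, y i ^ (i.val + 1)) →
      ((∏ i, z i ^ (i.val + 1) : ℕ) : ℝ) < C * ((∏ i, x i * y i * z i : ℕ) : ℝ) ^ (A + ε) := by
  have hZ : ∀ k : ℕ, 0 < Pell.yn Nat.one_lt_two (k + 1) := fun k => by
    have := Pell.yn_ge_n Nat.one_lt_two (k + 1); omega
  refine not_towerIneq_of_family (Q := fun x y _ => Nat.Coprime (∏ i, x i ^ (i.val + 1))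
      (∏ i, y i ^ (i.val + 1)))
    (fun _ => 1)
    (fun k => (Pi.mulSingle (⟨0, by omega⟩ : Fin n) 3 : Fin n → ℕ) *
      (Pi.mulSingle (⟨1, hn⟩ : Fin n) (Pell.yn Nat.one_lt_two (k + 1)) : Fin n → ℕ))
    (fun k => (Pi.mulSingle (⟨1, hn⟩ : Fin n) (Pell.xn Nat.one_lt_two (k + 1)) : Fin n → ℕ))
    (fun k i => ⟨Nat.one_pos, ?_, mulSingle_pos _ (Pell.x_pos _ _) i⟩)
    (fun k => ?_) (fun k => ?_) (p := 1) (q := 1) (by norm_num) (α := 1 / 2) (by norm_num)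
    (fun k => ?_) (fun K => ?_) (by push_cast; linarith)
  · simp only [Pi.mul_apply]
    exact Nat.mul_pos (mulSingle_pos _ (by norm_num) i) (mulSingle_pos _ (hZ k) i)
  · obtain ⟨h1, h2, h3, -⟩ := familyP_spec hn (Pell.xn Nat.one_lt_two (k + 1))
      (Pell.yn Nat.one_lt_two (k + 1))
    rw [h1, h2, h3, pell_sq]; ring
  · obtain ⟨h1, h2, -, -⟩ := familyP_spec hn (Pell.xn Nat.one_lt_two (k + 1))
      (Pell.yn Nat.one_lt_two (k + 1))
    show Nat.Coprime _ _
    rw [h1, h2]; exact Nat.coprime_one_left _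
  · obtain ⟨-, -, h3, h4⟩ := familyP_spec hn (Pell.xn Nat.one_lt_two (k + 1))
      (Pell.yn Nat.one_lt_two (k + 1))
    rw [h3, h4]
    have h5 : (3 * (Pell.yn Nat.one_lt_two (k + 1) : ℝ)) ≤ 2 * Pell.xn Nat.one_lt_two (k + 1) := by
      exact_mod_cast pell_three_yn_le (k + 1)
    have h6 : (0:ℝ) ≤ Pell.xn Nat.one_lt_two (k + 1) := by exact_mod_cast Nat.zero_le _
    push_cast; simp only [pow_one]; nlinarith
  · obtain ⟨k, hk⟩ := exists_nat_ge K
    refine ⟨k, ?_⟩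
    obtain ⟨-, -, -, h4⟩ := familyP_spec hn (Pell.xn Nat.one_lt_two (k + 1))
      (Pell.yn Nat.one_lt_two (k + 1))
    rw [h4]
    have h5 : (k : ℝ) + 1 < Pell.xn Nat.one_lt_two (k + 1) := by
      exact_mod_cast Pell.n_lt_xn Nat.one_lt_two (k + 1)
    have h6 : (1 : ℝ) ≤ Pell.yn Nat.one_lt_two (k + 1) := by exact_mod_cast hZ k
    push_cast; nlinarith

/-! ## Levels `≤ 3` are dead; the `∀ n` strengthening is false -/

/-- **Any window witness `(n, A)` has `n ≥ 4` and `A ≥ 1`** (floors `1/2` at level `1`, `1` at levels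
`≥ 2`, against `3A < n`). [folklore] -/
theorem four_le_of_window {n : ℕ} (hn : 1 ≤ n) {A : ℝ} (h3 : 3 * A < n)
    (h : ∀ ε : ℝ, 0 < ε → ∃ C : ℝ, 0 < C ∧ ∀ x y z : Fin n → ℕ, (∀ i, 0 < x i ∧ 0 < y i ∧ 0 < z i) →
      (∏ i, x i ^ (i.val + 1)) + (∏ i, y i ^ (i.val + 1)) = ∏ i, z i ^ (i.val + 1) →
      Nat.Coprime (∏ i, x i ^ (i.val + 1)) (∏ i, y i ^ (i.val + 1)) →
      ((∏ i, z i ^ (i.val + 1) : ℕ) : ℝ) < C * ((∏ i, x i * y i * z i : ℕ) : ℝ) ^ (A + ε)) :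
    4 ≤ n ∧ 1 ≤ A := by
  rcases Nat.lt_or_ge n 2 with hlt | hge
  · have hn1 : n = 1 := by omega
    subst hn1
    have hA : 1 / 2 ≤ A := not_lt.mp fun hA => not_towerIneq_of_lt_half le_rfl hA h
    norm_num at h3; exact absurd h3 (by linarith)
  · have hA : 1 ≤ A := not_lt.mp fun hA => not_towerIneq_of_lt_one hge hA h
    refine ⟨?_, hA⟩
    by_contra hlt
    have : (n:ℝ) ≤ 3 := by exact_mod_cast (by omega : n ≤ 3)
    linarith

/-- The crux can only be witnessed from level `4` on, with `A ∈ [1, n/3)`. [folklore] -/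
theorem towerExponentWindow_level_ge_four (h : TowerExponentWindow) :
    ∃ n : ℕ, 4 ≤ n ∧ ∃ A : ℝ, 1 ≤ A ∧ 3 * A < n ∧
      ∀ ε : ℝ, 0 < ε → ∃ C : ℝ, 0 < C ∧ ∀ x y z : Fin n → ℕ, (∀ i, 0 < x i ∧ 0 < y i ∧ 0 < z i) →
      (∏ i, x i ^ (i.val + 1)) + (∏ i, y i ^ (i.val + 1)) = ∏ i, z i ^ (i.val + 1) →
      Nat.Coprime (∏ i, x i ^ (i.val + 1)) (∏ i, y i ^ (i.val + 1)) →
      ((∏ i, z i ^ (i.val + 1) : ℕ) : ℝ) < C * ((∏ i, x i * y i * z i : ℕ) : ℝ) ^ (A + ε) := by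
  obtain ⟨n, hn, A, -, h3, hT⟩ := h
  obtain ⟨h4, hA⟩ := four_le_of_window hn h3 hT
  exact ⟨n, h4, A, hA, h3, hT⟩

/-- STRENGTHENING REFUTED: the window at some level `n ≤ 3`. [folklore] -/
theorem not_towerExponentWindow_le_three :
    ¬ ∃ n : ℕ, 1 ≤ n ∧ n ≤ 3 ∧ ∃ A : ℝ, 0 < A ∧ 3 * A < n ∧
      ∀ ε : ℝ, 0 < ε → ∃ C : ℝ, 0 < C ∧ ∀ x y z : Fin n → ℕ, (∀ i, 0 < x i ∧ 0 < y i ∧ 0 < z i) →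
      (∏ i, x i ^ (i.val + 1)) + (∏ i, y i ^ (i.val + 1)) = ∏ i, z i ^ (i.val + 1) →
      Nat.Coprime (∏ i, x i ^ (i.val + 1)) (∏ i, y i ^ (i.val + 1)) →
      ((∏ i, z i ^ (i.val + 1) : ℕ) : ℝ) < C * ((∏ i, x i * y i * z i : ℕ) : ℝ) ^ (A + ε) := by
  rintro ⟨n, hn, hn3, A, -, h3, hT⟩
  have := (four_le_of_window hn h3 hT).1
  omega

/-- STRENGTHENING REFUTED: the window at EVERY level (level `1` already fails). [folklore] -/
theorem not_forall_level_window :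
    ¬ ∀ n : ℕ, 1 ≤ n → ∃ A : ℝ, 0 < A ∧ 3 * A < n ∧
      ∀ ε : ℝ, 0 < ε → ∃ C : ℝ, 0 < C ∧ ∀ x y z : Fin n → ℕ, (∀ i, 0 < x i ∧ 0 < y i ∧ 0 < z i) →
      (∏ i, x i ^ (i.val + 1)) + (∏ i, y i ^ (i.val + 1)) = ∏ i, z i ^ (i.val + 1) →
      Nat.Coprime (∏ i, x i ^ (i.val + 1)) (∏ i, y i ^ (i.val + 1)) →
      ((∏ i, z i ^ (i.val + 1) : ℕ) : ℝ) < C * ((∏ i, x i * y i * z i : ℕ) : ℝ) ^ (A + ε) := by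
  intro h
  obtain ⟨A, -, h3, hT⟩ := h 1 le_rfl
  have := (four_le_of_window le_rfl h3 hT).1
  omega

/-- Monotonicity of the tower inequality in the exponent. [folklore] -/
theorem towerIneq_mono {n : ℕ} {A A' : ℝ} (hAA' : A ≤ A')
    (h : ∀ ε : ℝ, 0 < ε → ∃ C : ℝ, 0 < C ∧ ∀ x y z : Fin n → ℕ, (∀ i, 0 < x i ∧ 0 < y i ∧ 0 < z i) →
      (∏ i, x i ^ (i.val + 1)) + (∏ i, y i ^ (i.val + 1)) = ∏ i, z i ^ (i.val + 1) →
      Nat.Coprime (∏ i, x i ^ (i.val + 1)) (∏ i, y i ^ (i.val + 1)) →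
      ((∏ i, z i ^ (i.val + 1) : ℕ) : ℝ) < C * ((∏ i, x i * y i * z i : ℕ) : ℝ) ^ (A + ε)) :
    ∀ ε : ℝ, 0 < ε → ∃ C : ℝ, 0 < C ∧ ∀ x y z : Fin n → ℕ, (∀ i, 0 < x i ∧ 0 < y i ∧ 0 < z i) →
      (∏ i, x i ^ (i.val + 1)) + (∏ i, y i ^ (i.val + 1)) = ∏ i, z i ^ (i.val + 1) →
      Nat.Coprime (∏ i, x i ^ (i.val + 1)) (∏ i, y i ^ (i.val + 1)) →
      ((∏ i, z i ^ (i.val + 1) : ℕ) : ℝ) < C * ((∏ i, x i * y i * z i : ℕ) : ℝ) ^ (A' + ε) := by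
  intro ε hε
  obtain ⟨C, hC, hall⟩ := h (A' - A + ε) (by linarith)
  refine ⟨C, hC, fun x y z hp he hc => ?_⟩
  have h1 := hall x y z hp he hc
  have h2 : A + (A' - A + ε) = A' + ε := by ring
  rwa [h2] at h1

end Summit.ABC.ABC.Theorems.TowerExponentWindow.Negative
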